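/-
Copyright (c) 2026. All rights reserved.
Released under Apache 2.0 license as described in the file LICENSE.
-/
import Mathlib.NumberTheory.ModularForms.DedekindEta
import Mathlib.Analysis.SpecialFunctions.Log.Summable
import Mathlib.Analysis.Complex.LocallyUniformLimit
import Mathlib.Analysis.RCLike.Sqrt
import Literature.NumberTheory.ModularForms.DedekindEtaLogTransformation
import Literature.NumberTheory.ModularForms.RademacherPhiCompositionProofs
import Literature.NumberTheory.ModularForms.EtaMultiplierRademacherPhi
import Literature.NumberTheory.EllipticCurves.ModularCurveEtaMultiplierProofs

/-!
# The logarithmic transformation law of the Dedekind eta function — PROOF of the named fact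

Written by planner p2 (cell bsd-rank2, GEN 39), landed by the lead bsd-rank2-star-p1 GEN 13, for the PRINT stub `Holds.stub_dedekindEtaLog` of line
kummer v7.4 (`stmt-BirchSwinnertonDyer-27046`): a sorry-free proof of the named fact
`Literature.NumberTheory.ModularForms.dedekindEta_logTransformationLaw`.
[cite: Apostol1990, Thm. 3.4] [cite: RademacherGrosswald1972, Ch. 4 A, eq. (57a) and (60)]

Construction: `logEta z = π i z / 12 + ∑' n, log (1 − qⁿ⁺¹)` (`q = e^{2πiz}`), holomorphic on `ℍ`,
with `exp ∘ logEta = η` and the `T`-law for free. The `S`-law `logEta (−1/z) = logEta z + ½ log z − πi/4`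
follows from the exponentiated law (tree: `eta_S_smul`) by uniqueness of continuous lifts on the
connected set `ℍ`, pinned at the fixed point `z = i`. The law for a general `γ = (a b; c d)`, `c > 0`,
with Rademacher's `Φ`, is then propagated algebraically: left/right `T`-shifts, and composition of two
laws with `c, c′, c″ > 0` using the landed composition law `rademacherPhiSL_mul`
(`Φ(M′M) = Φ(M′) + Φ(M) − 3`) and `log ((cz+d)(c′w+d′)) = log (cz+d) + log (c′w+d′)` (all three in `ℍ`);
Euclidean descent on `c`.

Main result: `dedekindEta_logTransformationLaw_holds`.
-/

noncomputable section

open Complex Filter Topology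
open scoped Real MatrixGroups UpperHalfPlane

namespace Literature.NumberTheory.ModularForms

namespace DedekindEtaLog

/-! ## §0. Uniqueness of continuous lifts through `exp` -/

/-- Two continuous lifts of the same function through `exp` on a preconnected set which agree at one
point agree everywhere (the fibre `2πiℤ` is discrete; intermediate value theorem). [folklore] -/
private theorem eq_of_cexp_eq {S : Set ℂ} (hS : IsPreconnected S) {g₁ g₂ : ℂ → ℂ}
    (h₁ : ContinuousOn g₁ S) (h₂ : ContinuousOn g₂ S) (hexp : ∀ z ∈ S, cexp (g₁ z) = cexp (g₂ z))
    {z₀ : ℂ} (hz₀ : z₀ ∈ S) (h0 : g₁ z₀ = g₂ z₀) {z : ℂ} (hz : z ∈ S) : g₁ z = g₂ z := by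
  have h2pi : (2 * π * I : ℂ) ≠ 0 := by simp [Real.pi_ne_zero, Complex.I_ne_zero]
  set k : ℂ → ℝ := fun w ↦ ((g₁ w - g₂ w) / (2 * π * I)).re with hk
  have hkcont : ContinuousOn k S :=
    Complex.continuous_re.comp_continuousOn ((h₁.sub h₂).div_const _)
  have hkint : ∀ w ∈ S, ∃ n : ℤ, k w = n ∧ g₁ w - g₂ w = n * (2 * π * I) := by
    intro w hw
    obtain ⟨n, hn⟩ := Complex.exp_eq_exp_iff_exists_int.mp (hexp w hw)
    have hsub : g₁ w - g₂ w = n * (2 * π * I) := by rw [hn]; ring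
    refine ⟨n, ?_, hsub⟩
    simp only [hk, hsub, mul_div_cancel_right₀ _ h2pi, Complex.intCast_re]
  have hk0 : k z₀ = 0 := by simp [hk, h0]
  obtain ⟨n, hkn, hn⟩ := hkint z hz
  suffices hn0 : n = 0 by
    rw [hn0, Int.cast_zero, zero_mul, sub_eq_zero] at hn
    exact hn
  -- every value of `k` between `k z` and `k z₀` is an integer
  have hval : ∀ x : ℝ, (x ∈ Set.Icc (k z) (k z₀) ∨ x ∈ Set.Icc (k z₀) (k z)) → ∃ m : ℤ, x = m := by
    intro x hx
    rcases hx with hx | hx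
    · obtain ⟨w, hw, hkw⟩ := hS.intermediate_value hz hz₀ hkcont hx
      obtain ⟨m, hkm, -⟩ := hkint w hw
      exact ⟨m, by rw [← hkw, hkm]⟩
    · obtain ⟨w, hw, hkw⟩ := hS.intermediate_value hz₀ hz hkcont hx
      obtain ⟨m, hkm, -⟩ := hkint w hw
      exact ⟨m, by rw [← hkw, hkm]⟩
  by_contra hne
  rcases lt_or_gt_of_ne hne with hlt | hgt
  · have hle : (n : ℝ) ≤ -1 := by exact_mod_cast (show n ≤ -1 by omega)
    obtain ⟨m, hm⟩ := hval ((n : ℝ) + 1 / 2) (Or.inl ⟨by rw [hkn]; linarith, by rw [hk0]; linarith⟩)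
    have h2 : ((2 * m : ℤ) : ℝ) = ((2 * n + 1 : ℤ) : ℝ) := by push_cast; linarith
    have h3 : 2 * m = 2 * n + 1 := by exact_mod_cast h2
    omega
  · have hle : (1 : ℝ) ≤ n := by exact_mod_cast (show 1 ≤ n by omega)
    obtain ⟨m, hm⟩ := hval ((n : ℝ) - 1 / 2) (Or.inr ⟨by rw [hk0]; linarith, by rw [hkn]; linarith⟩)
    have h2 : ((2 * m : ℤ) : ℝ) = ((2 * n - 1 : ℤ) : ℝ) := by push_cast; linarith
    have h3 : 2 * m = 2 * n - 1 := by exact_mod_cast h2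
    omega

/-! ## §1. Additivity of `log` for products staying in the upper half-plane -/

/-- If `x`, `y` and `x * y` all have positive imaginary part then `log (x y) = log x + log y`
(`arg x + arg y < π` since `im (xy) = |x||y| sin (arg x + arg y) > 0`). [folklore] -/
private theorem log_mul_of_im_pos {x y : ℂ} (hx : 0 < x.im) (hy : 0 < y.im) (hxy : 0 < (x * y).im) :
    Complex.log (x * y) = Complex.log x + Complex.log y := by
  have hx0 : x ≠ 0 := fun h ↦ by simp [h] at hx
  have hy0 : y ≠ 0 := fun h ↦ by simp [h] at hy
  have hax : 0 ≤ x.arg := Complex.arg_nonneg_iff.mpr hx.le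
  have hay : 0 ≤ y.arg := Complex.arg_nonneg_iff.mpr hy.le
  refine (Complex.log_mul_eq_add_log_iff hx0 hy0).mpr ⟨by linarith [Real.pi_pos], ?_⟩
  by_contra hle
  push Not at hle
  have hsin : Real.sin (x.arg + y.arg) ≤ 0 := by
    have h1 : 0 ≤ x.arg + y.arg - π := by linarith
    have h2 : x.arg + y.arg - π ≤ π := by linarith [Complex.arg_le_pi x, Complex.arg_le_pi y]
    have := Real.sin_nonneg_of_nonneg_of_le_pi h1 h2
    rw [Real.sin_sub_pi] at this
    linarith
  have hnx : ‖x‖ ≠ 0 := norm_ne_zero_iff.mpr hx0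
  have hny : ‖y‖ ≠ 0 := norm_ne_zero_iff.mpr hy0
  have him : (x * y).im = ‖x‖ * ‖y‖ * Real.sin (x.arg + y.arg) := by
    rw [Real.sin_add, Complex.sin_arg, Complex.cos_arg hx0, Complex.sin_arg, Complex.cos_arg hy0,
      Complex.mul_im]
    field_simp
    ring
  have : 0 ≤ ‖x‖ * ‖y‖ := by positivity
  nlinarith [hxy, him, hsin, this]

/-! ## §2. The holomorphic logarithm `logEta` -/

/-- `logEta z = π i z / 12 + ∑' n, log (1 − e^{2πi(n+1)z})`, the holomorphic branch of `log η` on `ℍ`.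
[cite: Apostol1990, Thm. 3.4] -/
private def logEta (z : ℂ) : ℂ := π * I * z / 12 + ∑' n : ℕ, Complex.log (1 - ModularForm.eta_q n z)

/-- `∑ log (1 − qⁿ⁺¹)` converges on `ℍ`. [folklore] -/
private theorem summable_log_one_sub_eta_q {z : ℂ} (hz : 0 < z.im) :
    Summable fun n : ℕ ↦ Complex.log (1 - ModularForm.eta_q n z) := by
  have h := Complex.summable_log_one_add_of_summable
    (Summable.of_norm (ModularForm.summable_eta_q ⟨z, hz⟩))
  simpa [sub_eq_add_neg] using h

/-- `exp (logEta z) = η z`. [cite: Apostol1990, Thm. 3.4] -/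
private theorem cexp_logEta {z : ℂ} (hz : 0 < z.im) : cexp (logEta z) = ModularForm.eta z := by
  rw [logEta, Complex.exp_add, ModularForm.eta,
    Complex.cexp_tsum_eq_tprod (fun n ↦ ModularForm.one_sub_eta_q_ne_zero n hz)
      (summable_log_one_sub_eta_q hz)]
  congr 1
  rw [Function.Periodic.qParam]
  congr 1
  push_cast
  ring

/-- `qⁿ⁺¹` is `1`-periodic. [folklore] -/
private theorem eta_q_add_int (n : ℕ) (z : ℂ) (b : ℤ) :
    ModularForm.eta_q n (z + b) = ModularForm.eta_q n z := by
  rw [ModularForm.eta_q_eq_cexp, ModularForm.eta_q_eq_cexp, mul_add, Complex.exp_add]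
  have h1 : cexp (2 * π * I * (n + 1) * (b : ℂ)) = 1 := by
    rw [Complex.exp_eq_one_iff]
    exact ⟨(n + 1) * b, by push_cast; ring⟩
  rw [h1, mul_one]

/-- The `T`-law: `logEta (z + b) = logEta z + π i b / 12`. [cite: Apostol1990, Thm. 3.4] -/
private theorem logEta_add_int (z : ℂ) (b : ℤ) : logEta (z + b) = logEta z + π * I * b / 12 := by
  simp only [logEta, eta_q_add_int]
  ring

/-- `‖log (1 − w)‖ ≤ C(r) ‖w‖` for `‖w‖ ≤ r < 1`. [folklore] -/
private theorem norm_log_one_sub_le {w : ℂ} {r : ℝ} (hr : r < 1) (hw : ‖w‖ ≤ r) :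
    ‖Complex.log (1 - w)‖ ≤ (r * (1 - r)⁻¹ / 2 + 1) * ‖w‖ := by
  have hw1 : ‖w‖ < 1 := hw.trans_lt hr
  have h := Complex.norm_log_one_add_le (z := -w) (by rwa [norm_neg])
  rw [norm_neg, ← sub_eq_add_neg] at h
  have hr0 : 0 ≤ r := (norm_nonneg w).trans hw
  have hfrac : ‖w‖ * (1 - ‖w‖)⁻¹ ≤ r * (1 - r)⁻¹ := by
    rw [← div_eq_mul_inv, ← div_eq_mul_inv, div_le_div_iff₀ (by linarith) (by linarith)]
    nlinarith
  have hw0 := norm_nonneg w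
  calc ‖Complex.log (1 - w)‖ ≤ ‖w‖ ^ 2 * (1 - ‖w‖)⁻¹ / 2 + ‖w‖ := h
    _ = (‖w‖ * (1 - ‖w‖)⁻¹) / 2 * ‖w‖ + ‖w‖ := by ring
    _ ≤ (r * (1 - r)⁻¹) / 2 * ‖w‖ + ‖w‖ := by gcongr
    _ = (r * (1 - r)⁻¹ / 2 + 1) * ‖w‖ := by ring

/-- `‖qⁿ⁺¹‖ ≤ e^{−2πε(n+1)}` on `{ε < im z}`. [folklore] -/
private theorem norm_eta_q_le {ε : ℝ} (n : ℕ) {z : ℂ} (hz : ε < z.im) :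
    ‖ModularForm.eta_q n z‖ ≤ Real.exp (-2 * π * ε) ^ (n + 1) := by
  rw [norm_pow, Function.Periodic.norm_qParam]
  apply pow_le_pow_left₀ (Real.exp_nonneg _)
  rw [Real.exp_le_exp, div_one]
  nlinarith [Real.pi_pos]

/-- `logEta` is holomorphic on each half-plane `{ε < im z}`, `ε > 0` (normal convergence of `∑ log (1 − qⁿ)`). [folklore] -/
private theorem differentiableOn_logEta_of_lt {ε : ℝ} (hε : 0 < ε) :
    DifferentiableOn ℂ logEta {z : ℂ | ε < z.im} := by
  set ρ : ℝ := Real.exp (-2 * π * ε) with hρ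
  have hρ0 : 0 ≤ ρ := Real.exp_nonneg _
  have hρ1 : ρ < 1 := Real.exp_lt_one_iff.mpr (by nlinarith [Real.pi_pos])
  have hU : IsOpen {z : ℂ | ε < z.im} := isOpen_lt continuous_const Complex.continuous_im
  set C : ℝ := ρ * (1 - ρ)⁻¹ / 2 + 1 with hC
  have hC0 : 0 ≤ C := by
    have : 0 ≤ (1 - ρ)⁻¹ := inv_nonneg.mpr (by linarith)
    positivity
  have hsum : Summable fun n : ℕ ↦ C * ρ ^ (n + 1) := by
    have := (summable_geometric_of_lt_one hρ0 hρ1).mul_left (C * ρ)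
    refine this.congr fun n ↦ ?_
    ring
  apply DifferentiableOn.add
  · intro z hz
    exact (by fun_prop : Differentiable ℂ fun z : ℂ ↦ π * I * z / 12).differentiableAt.differentiableWithinAt
  · refine differentiableOn_tsum_of_summable_norm hsum (fun n ↦ ?_) hU (fun n w hw ↦ ?_)
    · intro z hz
      have hz0 : 0 < z.im := hε.trans hz
      have hd : Differentiable ℂ fun z : ℂ ↦ 1 - ModularForm.eta_q n z := by
        simp only [ModularForm.eta_q_eq_cexp]
        fun_prop
      refine ((hd z).clog ?_).differentiableWithinAt
      rw [sub_eq_add_neg]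
      apply Complex.mem_slitPlane_of_norm_lt_one
      rw [norm_neg]
      exact (norm_eta_q_le n hz).trans_lt
        ((pow_le_of_le_one hρ0 hρ1.le (Nat.succ_ne_zero n)).trans_lt hρ1)
    · exact (norm_log_one_sub_le hρ1 ((norm_eta_q_le n hw).trans
        (pow_le_of_le_one hρ0 hρ1.le (Nat.succ_ne_zero n)))).trans
        (mul_le_mul_of_nonneg_left (norm_eta_q_le n hw) hC0)

/-- `logEta` is holomorphic on the upper half-plane. [folklore] -/
private theorem differentiableOn_logEta : DifferentiableOn ℂ logEta {z : ℂ | 0 < z.im} := by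
  intro z hz
  have hz' : 0 < z.im := hz
  have h := differentiableOn_logEta_of_lt (half_pos hz')
  have hzU : z ∈ {w : ℂ | z.im / 2 < w.im} := by
    simp only [Set.mem_setOf_eq]
    linarith
  exact (h.differentiableAt ((isOpen_lt continuous_const Complex.continuous_im).mem_nhds
    hzU)).differentiableWithinAt

/-- `logEta` is continuous on `ℍ`. [folklore] -/
private theorem continuousOn_logEta : ContinuousOn logEta {z : ℂ | 0 < z.im} :=
  differentiableOn_logEta.continuousOn

/-! ## §3. The `S`-law by lift uniqueness at the fixed point `i` -/

/-- `−1/z ∈ ℍ` for `z ∈ ℍ`. [folklore] -/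
private theorem im_neg_inv_pos {z : ℂ} (hz : 0 < z.im) : 0 < ((-z)⁻¹).im := by
  have hz0 : z ≠ 0 := fun h ↦ by simp [h] at hz
  rw [← neg_inv, Complex.neg_im, Complex.inv_im, neg_div, neg_neg]
  exact div_pos hz (Complex.normSq_pos.mpr hz0)

/-- The `S`-law `logEta (−1/z) = logEta z + ½ log z − π i / 4`, from `η(−1/z) = e^{−πi/4} √z η(z)` by lift
uniqueness pinned at `z = i`. [cite: Apostol1990, Thm. 3.1 and Thm. 3.4] -/
private theorem logEta_S {z : ℂ} (hz : 0 < z.im) :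
    logEta ((-z)⁻¹) = logEta z + Complex.log z / 2 - π * I / 4 := by
  have hS : IsPreconnected {z : ℂ | 0 < z.im} := (convex_halfSpace_im_gt 0).isPreconnected
  have hI : (I : ℂ) ∈ {z : ℂ | 0 < z.im} := by simp
  refine eq_of_cexp_eq hS (g₁ := fun z ↦ logEta ((-z)⁻¹))
    (g₂ := fun z ↦ logEta z + Complex.log z / 2 - π * I / 4) ?_ ?_ ?_ hI ?_ hz
  · refine continuousOn_logEta.comp ?_ (fun w hw ↦ im_neg_inv_pos hw)
    refine ContinuousOn.inv₀ (continuousOn_neg) (fun w hw ↦ ?_)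
    exact neg_ne_zero.mpr (fun h ↦ by simp [h] at hw)
  · refine (continuousOn_logEta.add (ContinuousOn.div_const (fun w hw ↦ ?_) _)).sub
      continuousOn_const
    exact (continuousAt_clog (Complex.mem_slitPlane_iff.mpr
      (Or.inr (ne_of_gt hw)))).continuousWithinAt
  · intro w hw
    have hw0 : w ≠ 0 := fun h ↦ by simp [h] at hw
    have hcoe : (((ModularGroup.S • (⟨w, hw⟩ : ℍ) : ℍ)) : ℂ) = (-w)⁻¹ := by
      rw [UpperHalfPlane.modular_S_smul]
    have key := Literature.NumberTheory.EllipticCurves.ModularForms.eta_S_smul (⟨w, hw⟩ : ℍ)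
    rw [hcoe] at key
    rw [cexp_logEta (im_neg_inv_pos hw), key, sub_eq_add_neg, Complex.exp_add, Complex.exp_add,
      cexp_logEta hw, ← sqrt_eq_exp hw0]
    dsimp only
    ring_nf
  · rw [← neg_inv, Complex.inv_I, neg_neg, Complex.log_I]
    ring

/-! ## §4. Algebraic propagation: `T`-shifts, composition, Euclidean descent -/

/-- The logarithmic law for one matrix `(a b; c d)`, in the shape of the named fact
`dedekindEta_logTransformationLaw`. [cite: Apostol1990, Thm. 3.4] -/
private def LogLaw (L : ℂ → ℂ) (a b c d : ℤ) : Prop :=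
  ∀ z : ℂ, 0 < z.im → L ((a * z + b) / (c * z + d)) =
    L z + Complex.log (c * z + d) / 2 + Real.pi * Complex.I * (((rademacherPhi a b c d : ℚ) : ℂ) - 3) / 12

/-- `im (cz + d) = c · im z` for integers `c, d`. [folklore] -/
private theorem denom_im {c d : ℤ} (z : ℂ) : ((c : ℂ) * z + d).im = c * z.im := by simp

/-- `cz + d ≠ 0` for `c > 0`, `z ∈ ℍ`. [folklore] -/
private theorem denom_ne_zero_of_pos {c d : ℤ} (hc : 0 < c) {z : ℂ} (hz : 0 < z.im) :
    (c : ℂ) * z + d ≠ 0 := by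
  intro h
  have him := congrArg Complex.im h
  rw [denom_im, Complex.zero_im] at him
  have : (0 : ℝ) < c * z.im := mul_pos (by exact_mod_cast hc) hz
  exact this.ne' him

/-- `(az+b)/(cz+d) ∈ ℍ` for `ad − bc = 1`, `c > 0`, `z ∈ ℍ`. [folklore] -/
private theorem moebius_im_pos {a b c d : ℤ} (hdet : a * d - b * c = 1) (hc : 0 < c) {z : ℂ}
    (hz : 0 < z.im) : 0 < (((a : ℂ) * z + b) / ((c : ℂ) * z + d)).im := by
  have hv := denom_ne_zero_of_pos (d := d) hc hz
  have hns : 0 < Complex.normSq ((c : ℂ) * z + d) := Complex.normSq_pos.mpr hv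
  have hdet' : (a : ℝ) * d - b * c = 1 := by exact_mod_cast hdet
  have hnum : ((a : ℂ) * z + b).im * ((c : ℂ) * z + d).re -
      ((a : ℂ) * z + b).re * ((c : ℂ) * z + d).im = z.im := by
    simp only [Complex.add_re, Complex.add_im, Complex.mul_re, Complex.mul_im,
      Complex.intCast_re, Complex.intCast_im, zero_mul, sub_zero, add_zero]
    linear_combination z.im * hdet'
  rw [Complex.div_im, div_sub_div_same, hnum]
  exact div_pos hz hns

/-- The `S`-law in `LogLaw` form (`Φ(S) = 0`). [cite: RademacherGrosswald1972, Ch. 4 A, eq. (60)] -/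
private theorem logLaw_S : LogLaw logEta 0 (-1) 1 0 := by
  intro z hz
  have hΦ : rademacherPhi 0 (-1) 1 0 = 0 := by
    rw [rademacherPhi_of_c_ne_zero one_ne_zero]
    simp
  rw [hΦ]
  push_cast
  rw [zero_mul, zero_add, one_mul, add_zero, show (-1 : ℂ) / z = (-z)⁻¹ by
    rw [neg_div, one_div, neg_inv], logEta_S hz]
  ring

/-- Left shift: the law for `M` gives the law for `Tⁿ M` (`Φ(TⁿM) = Φ(M) + n`). [cite: RademacherGrosswald1972, Ch. 4 A, eq. (62)] -/
private theorem logLaw_shift_left {L : ℂ → ℂ} (hT : ∀ z : ℂ, 0 < z.im → ∀ n : ℤ, L (z + n) = L z + π * I * n / 12)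
    {a b c d : ℤ} (hdet : a * d - b * c = 1) (hc : 0 < c) (h : LogLaw L a b c d) (n : ℤ) :
    LogLaw L (a + n * c) (b + n * d) c d := by
  intro z hz
  have hv := denom_ne_zero_of_pos (d := d) hc hz
  have hmob : (((a + n * c : ℤ) : ℂ) * z + ((b + n * d : ℤ) : ℂ)) / ((c : ℂ) * z + d) =
      ((a : ℂ) * z + b) / ((c : ℂ) * z + d) + n := by
    have hnum : ((a + n * c : ℤ) : ℂ) * z + ((b + n * d : ℤ) : ℂ) =
        ((a : ℂ) * z + b) + n * ((c : ℂ) * z + d) := by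
      push_cast
      ring
    rw [hnum, add_div, mul_div_cancel_right₀ _ hv]
  have hΦ : rademacherPhi (a + n * c) (b + n * d) c d = rademacherPhi a b c d + n := by
    rw [rademacherPhi_of_c_ne_zero hc.ne', rademacherPhi_of_c_ne_zero hc.ne']
    have : (c : ℚ) ≠ 0 := by exact_mod_cast hc.ne'
    field_simp
    push_cast
    ring
  rw [hmob, hT _ (moebius_im_pos hdet hc hz) n, h z hz, hΦ]
  push_cast
  ring

/-- Right shift: the law for `M` gives the law for `M Tⁿ` (`Φ(MTⁿ) = Φ(M) + n`). [cite: RademacherGrosswald1972, Ch. 4 A, eq. (62)] -/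
private theorem logLaw_shift_right {L : ℂ → ℂ} (hT : ∀ z : ℂ, 0 < z.im → ∀ n : ℤ, L (z + n) = L z + π * I * n / 12)
    {a b c d : ℤ} (hc : 0 < c) (h : LogLaw L a b c d) (n : ℤ) :
    LogLaw L a (b + n * a) c (d + n * c) := by
  intro z hz
  have hz' : 0 < (z + n).im := by simpa using hz
  have hmob : ((a : ℂ) * z + ((b + n * a : ℤ) : ℂ)) / ((c : ℂ) * z + ((d + n * c : ℤ) : ℂ)) =
      ((a : ℂ) * (z + n) + b) / ((c : ℂ) * (z + n) + d) := by
    push_cast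
    ring
  have hden : (c : ℂ) * (z + n) + d = (c : ℂ) * z + ((d + n * c : ℤ) : ℂ) := by
    push_cast
    ring
  rw [hmob, h (z + n) hz', hT z hz n, hden, rademacherPhi_T_zpow_shift hc a b d n]
  push_cast
  ring

/-- An `SL(2, ℤ)` element from four integers. [folklore] -/
private def mk4 (a b c d : ℤ) (h : a * d - b * c = 1) : SL(2, ℤ) :=
  ⟨!![a, b; c, d], by rw [Matrix.det_fin_two_of]; linarith⟩

/-- Rademacher's composition law for quadruples with `c, c′, c″ > 0`: `Φ(M′M) = Φ(M′) + Φ(M) − 3`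
(tree `rademacherPhiSL_mul`). [cite: RademacherGrosswald1972, Ch. 4 A, eq. (61)] -/
private theorem rademacherPhi_comp {a' b' c' d' a b c d : ℤ} (hdet' : a' * d' - b' * c' = 1)
    (hdet : a * d - b * c = 1) (hc' : 0 < c') (hc : 0 < c) (hc'' : 0 < c' * a + d' * c) :
    rademacherPhi (a' * a + b' * c) (a' * b + b' * d) (c' * a + d' * c) (c' * b + d' * d) =
      rademacherPhi a' b' c' d' + rademacherPhi a b c d - 3 := by
  have key := rademacherPhiSL_mul (mk4 a' b' c' d' hdet') (mk4 a b c d hdet)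
  have hM' : ((mk4 a' b' c' d' hdet' : SL(2, ℤ)) : Matrix (Fin 2) (Fin 2) ℤ) = !![a', b'; c', d'] := rfl
  have hM : ((mk4 a b c d hdet : SL(2, ℤ)) : Matrix (Fin 2) (Fin 2) ℤ) = !![a, b; c, d] := rfl
  have hmul : ((mk4 a' b' c' d' hdet' * mk4 a b c d hdet : SL(2, ℤ)) : Matrix (Fin 2) (Fin 2) ℤ) =
      !![a' * a + b' * c, a' * b + b' * d; c' * a + d' * c, c' * b + d' * d] := by
    rw [Matrix.SpecialLinearGroup.coe_mul, hM', hM, Matrix.mul_fin_two]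
  rw [rademacherPhiSL_apply, rademacherPhiSL_apply, rademacherPhiSL_apply] at key
  simp only [hmul, hM', hM, Matrix.of_apply, Matrix.cons_val', Matrix.cons_val_zero,
    Matrix.cons_val_one, Matrix.empty_val', Matrix.cons_val_fin_one] at key
  rw [Int.sign_eq_one_of_pos (by positivity)] at key
  rw [key]
  push_cast
  ring

/-- Composition: laws for `M′ = (a′ b′; c′ d′)` and `M = (a b; c d)` with `c, c′, c″ > 0` give the law
for `M′ M`. [cite: RademacherGrosswald1972, Ch. 4 A, eq. (61)–(62)] -/
private theorem logLaw_comp {L : ℂ → ℂ} {a' b' c' d' a b c d : ℤ} (hdet' : a' * d' - b' * c' = 1)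
    (hdet : a * d - b * c = 1) (hc' : 0 < c') (hc : 0 < c) (hc'' : 0 < c' * a + d' * c)
    (h' : LogLaw L a' b' c' d') (h : LogLaw L a b c d) :
    LogLaw L (a' * a + b' * c) (a' * b + b' * d) (c' * a + d' * c) (c' * b + d' * d) := by
  intro z hz
  have hv := denom_ne_zero_of_pos (d := d) hc hz
  obtain ⟨w, hw⟩ : ∃ w : ℂ, ((a : ℂ) * z + b) / ((c : ℂ) * z + d) = w := ⟨_, rfl⟩
  have hwpos : 0 < w.im := hw ▸ moebius_im_pos hdet hc hz
  have hv' := denom_ne_zero_of_pos (d := d') hc' hwpos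
  have hVw : ((c : ℂ) * z + d) * w = (a : ℂ) * z + b := by
    rw [← hw, mul_div_assoc', mul_div_cancel_left₀ _ hv]
  have hprod : ((c : ℂ) * z + d) * ((c' : ℂ) * w + d') =
      ((c' * a + d' * c : ℤ) : ℂ) * z + ((c' * b + d' * d : ℤ) : ℂ) := by
    calc ((c : ℂ) * z + d) * ((c' : ℂ) * w + d')
        = (c' : ℂ) * (((c : ℂ) * z + d) * w) + d' * ((c : ℂ) * z + d) := by ring
      _ = _ := by rw [hVw]; push_cast; ring
  have hv'' : ((c' * a + d' * c : ℤ) : ℂ) * z + ((c' * b + d' * d : ℤ) : ℂ) ≠ 0 := by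
    rw [← hprod]
    exact mul_ne_zero hv hv'
  have hcomp : (((a' * a + b' * c : ℤ) : ℂ) * z + ((a' * b + b' * d : ℤ) : ℂ)) /
      (((c' * a + d' * c : ℤ) : ℂ) * z + ((c' * b + d' * d : ℤ) : ℂ)) =
      ((a' : ℂ) * w + b') / ((c' : ℂ) * w + d') := by
    have hX : ((a' * a + b' * c : ℤ) : ℂ) * z + ((a' * b + b' * d : ℤ) : ℂ) =
        ((c : ℂ) * z + d) * ((a' : ℂ) * w + b') := by
      calc ((a' * a + b' * c : ℤ) : ℂ) * z + ((a' * b + b' * d : ℤ) : ℂ)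
          = (a' : ℂ) * ((a : ℂ) * z + b) + b' * ((c : ℂ) * z + d) := by push_cast; ring
        _ = _ := by rw [← hVw]; ring
    rw [div_eq_div_iff hv'' hv', hX, ← hprod]
    ring
  have him1 : 0 < ((c : ℂ) * z + d).im := by
    rw [denom_im]; exact mul_pos (by exact_mod_cast hc) hz
  have him2 : 0 < ((c' : ℂ) * w + d').im := by
    rw [denom_im]; exact mul_pos (by exact_mod_cast hc') hwpos
  have him3 : 0 < (((c : ℂ) * z + d) * ((c' : ℂ) * w + d')).im := by
    rw [hprod, denom_im]; exact mul_pos (by exact_mod_cast hc'') hz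
  have hz1 := h z hz
  rw [hw] at hz1
  rw [hcomp, h' w hwpos, hz1, ← hprod, log_mul_of_im_pos him1 him2 him3,
    rademacherPhi_comp hdet' hdet hc' hc hc'']
  push_cast
  ring

/-- Euclidean descent: the `S`-law and the `T`-law give the law for every `(a b; c d)` with `c > 0`
(`γ = (TⁿS)·γ₁` with `0 < c₁ < c`; base `c = 1`: `γ = Tᵃ S Tᵈ`). [cite: Apostol1990, Thm. 3.4] -/
private theorem logLaw_of_pos {L : ℂ → ℂ} (hT : ∀ z : ℂ, 0 < z.im → ∀ n : ℤ, L (z + n) = L z + π * I * n / 12)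
    (hS : LogLaw L 0 (-1) 1 0) :
    ∀ (k : ℕ) (a b c d : ℤ), a * d - b * c = 1 → c = (k : ℤ) + 1 → LogLaw L a b c d := by
  intro k
  induction k using Nat.strong_induction_on with
  | _ k ih =>
  intro a b c d hdet hck
  have hc : 0 < c := by omega
  -- the law for `Tⁿ S = (n, -1; 1, 0)`
  have hTS : ∀ n : ℤ, LogLaw L n (-1) 1 0 := by
    intro n
    have := logLaw_shift_left hT (a := 0) (b := -1) (c := 1) (d := 0) (by norm_num) one_pos hS n
    simp only [mul_one, zero_add, mul_zero, add_zero] at this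
    exact this
  by_cases hdiv : c ∣ a
  · -- then `c = 1` and `γ = Tᵃ S Tᵈ`
    have hc1 : c = 1 := by
      obtain ⟨m, hm⟩ := hdiv
      refine Int.eq_one_of_dvd_one hc.le ⟨m * d - b, ?_⟩
      rw [hm] at hdet
      linear_combination -hdet
    subst hc1
    have hb : b = -1 + d * a := by linarith
    have h1 := logLaw_shift_right hT (a := a) (b := -1) (c := 1) (d := 0) one_pos (hTS a) d
    simp only [mul_one, zero_add] at h1
    rw [hb]
    exact h1
  · -- descent: `γ = (Tⁿ S) γ₁` with `0 < c₁ < c`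
    have hmod0 : 0 ≤ a % c := Int.emod_nonneg a hc.ne'
    have hmodlt : a % c < c := Int.emod_lt_of_pos a hc
    have hdecomp : a % c + c * (a / c) = a := by rw [Int.emod_def]; ring
    have hmodne : a % c ≠ 0 := fun h0 ↦ hdiv (Int.dvd_of_emod_eq_zero h0)
    set n : ℤ := a / c + 1 with hn
    set c₁ : ℤ := n * c - a with hc₁
    have hc₁eq : c₁ = c - a % c := by rw [hc₁, hn]; linear_combination hdecomp
    have hc₁pos : 0 < c₁ := by rw [hc₁eq]; omega
    have hc₁lt : c₁ < c := by rw [hc₁eq]; omega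
    have hdet₁ : c * (n * d - b) - d * c₁ = 1 := by rw [hc₁]; linear_combination hdet
    have ih₁ : LogLaw L c d c₁ (n * d - b) :=
      ih (c₁ - 1).toNat (by omega) c d c₁ (n * d - b) hdet₁ (by omega)
    have hcomp := logLaw_comp (L := L) (a' := n) (b' := -1) (c' := 1) (d' := 0)
      (by ring) hdet₁ one_pos hc₁pos (by linarith) (hTS n) ih₁
    have e1 : n * c + -1 * c₁ = a := by rw [hc₁]; ring
    have e2 : n * d + -1 * (n * d - b) = b := by ring
    have e3 : 1 * c + 0 * c₁ = c := by ring
    have e4 : 1 * d + 0 * (n * d - b) = d := by ring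
    rw [e1, e2, e3, e4] at hcomp
    exact hcomp

end DedekindEtaLog

/-! ## §5. The named fact -/

open DedekindEtaLog in

/-- **K-D.** The logarithmic transformation law of the Dedekind eta function with Rademacher's `Φ`
(the named fact `dedekindEta_logTransformationLaw`, proved).
[cite: Apostol1990, Thm. 3.4] [cite: RademacherGrosswald1972, Ch. 4 A, eq. (57a) and (60)] -/
theorem dedekindEta_logTransformationLaw_holds : dedekindEta_logTransformationLaw := by
  refine ⟨logEta, differentiableOn_logEta, fun z hz ↦ cexp_logEta hz,
    fun z _ b ↦ logEta_add_int z b, ?_⟩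
  intro a b c d hdet hc z hz
  obtain ⟨k, hk⟩ := Int.eq_ofNat_of_zero_le hc.le
  have hk1 : 1 ≤ k := by exact_mod_cast (hk ▸ hc : (0 : ℤ) < k)
  exact logLaw_of_pos (fun z _ n ↦ logEta_add_int z n) logLaw_S (k - 1) a b c d hdet
    (by push_cast [Nat.cast_sub hk1]; omega) z hz

end Literature.NumberTheory.ModularForms

end
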